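import Summits.ValiantsHypothesis.ValiantsHypothesis.Theorems.SymPencilEquivariantSdcNotQPYoungFixedVectorSpecht
import Literature.NumberTheory.DiophantineGeometry.SymmetricGroupRepsCompletenessProofs
import Literature.NumberTheory.DiophantineGeometry.SymmetricGroupRepsFinrankSpechtProofs
import HarnessLib

/-!
# ValiantsHypothesis / SymPencil — crux `EquivariantSdcNotQP` (stmt-ValiantsHypothesis-17792), line
# `birth_EquivariantSdcNotQP`, stub `stub_permify`, hypothesis (H2) `YoungFixedVector`: step 2 —
# FIXED VECTORS OF YOUNG SUBGROUPS IN REPRESENTATIONS OF THE ALTERNATING GROUP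

`alternating_fixed_vector`: every nonzero finite-dimensional complex representation `V` of `𝔄_n` admits
a partition `λ ⊢ n` with `f^λ ≤ 2 dim V` such that, for `ν = λ` AND for `ν = λᵗ`, some subgroup
`Y ≤ 𝔄_n` of index `≤ [𝔖_n : R_ν]` (a conjugate of `R_ν ∩ 𝔄_n`, `R_ν` the Young row group) fixes a
nonzero vector of `V`.  Proof (helper of the item, `--supports stmt-ValiantsHypothesis-17792 --as helper`;
0 definitions — the induced module is built inside the proof —, 0 named facts): induce to `𝔖_n` in the
function model `U = {f : 𝔖_n → V | f(a x) = ρ(a) f(x)}` (right translation), `dim U ≤ 2 dim V`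
(evaluation at two coset representatives), take an irreducible subrepresentation
(`exists_irreducible_subrepresentation`), identify it with a Specht module `S^λ` by the tree's
COMPLETENESS theorem `exists_equiv_spechtRep_of_isIrreducible_holds` and `finrank_spechtIdeal_holds`
(`dim S^λ = f^λ`), transport the Young fixed vectors of step 1 (`exists_fixed_rowStabilizer(_transpose)`),
and evaluate the resulting `R_ν ∩ 𝔄_n`-invariant function at a point `x₀` where it is nonzero: the value
is fixed by `x₀ (R_ν ∩ 𝔄_n) x₀⁻¹` (`index_conj_inf_subgroupOf_le`).

Honest framing: classical (Frobenius reciprocity + Young's rule for `𝔄_n ≤ 𝔖_n`); (H2), (H1),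
`stub_permify`, the crux `SymPencil.EquivariantSdcNotQP` and `VP ≠ VNP` remain OPEN here.
-/

noncomputable section

set_option linter.dupNamespace false

namespace Summit.ValiantsHypothesis.ValiantsHypothesis.Theorems.SymPencilEquivariantSdcNotQP.YoungBounds

open Literature.NumberTheory.DiophantineGeometry

/-- Index bookkeeping: for `H ≤ 𝔖_n` and `x ∈ 𝔖_n`, the subgroup `x (H ∩ 𝔄_n) x⁻¹`, seen inside `𝔄_n`,
has index `≤ [𝔖_n : H]`. [folklore] -/
theorem index_conj_inf_subgroupOf_le {n : ℕ} (H : Subgroup (Equiv.Perm (Fin n))) (x : Equiv.Perm (Fin n)) :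
    (((H ⊓ alternatingGroup (Fin n)).map
        ((MulAut.conj x : Equiv.Perm (Fin n) ≃* Equiv.Perm (Fin n)) :
          Equiv.Perm (Fin n) →* Equiv.Perm (Fin n))).subgroupOf (alternatingGroup (Fin n))).index ≤
      H.index := by
  set A := alternatingGroup (Fin n) with hA
  set K := (H ⊓ A).map ((MulAut.conj x : Equiv.Perm (Fin n) ≃* Equiv.Perm (Fin n)) :
    Equiv.Perm (Fin n) →* Equiv.Perm (Fin n)) with hK
  have hKA : K ≤ A := by
    rintro _ ⟨p, hp, rfl⟩
    have hpA : p ∈ A := hp.2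
    change (MulAut.conj x) p ∈ A
    rw [MulAut.conj_apply]
    exact (inferInstance : A.Normal).conj_mem p hpA x
  have h1 : K.relIndex A * A.index = K.index := Subgroup.relIndex_mul_index hKA
  have h2 : K.index = (H ⊓ A).index := Subgroup.index_map_equiv (H ⊓ A) _
  have h3 : (H ⊓ A).index ≤ H.index * A.index := Subgroup.index_inf_le
  have hApos : 0 < A.index := Nat.pos_of_ne_zero Subgroup.index_ne_zero_of_finite
  change K.relIndex A ≤ H.index
  have : K.relIndex A * A.index ≤ H.index * A.index := by rw [h1, h2]; exact h3
  exact Nat.le_of_mul_le_mul_right this hApos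

/-- **Fixed vectors of Young subgroups in representations of `𝔄_n`.**  Every nonzero finite-dimensional
complex representation `V` of `𝔄_n` admits a partition `λ ⊢ n` with `f^λ ≤ 2 dim V` such that for
`ν = λ` and for `ν = λᵗ` a subgroup `Y ≤ 𝔄_n` of index `≤ [𝔖_n : R_ν]` fixes a nonzero vector of `V`
(induction to `𝔖_n`, completeness of the Specht modules, Young's rule; the transposed orientation through
`S^{λᵗ} ≅ S^λ ⊗ sgn`). [folklore] -/
theorem alternating_fixed_vector (n : ℕ) {V : Type} [AddCommGroup V] [Module ℂ V]
    [FiniteDimensional ℂ V] [Nontrivial V]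
    (ρ : Representation ℂ ↥(alternatingGroup (Fin n)) V) :
    ∃ lam : Nat.Partition n, numStandardTableaux lam ≤ 2 * Module.finrank ℂ V ∧
      ∀ ν : Nat.Partition n, (ν = lam ∨ ν = lam.transpose) →
        ∃ Y : Subgroup ↥(alternatingGroup (Fin n)), Y.index ≤ (rowStabilizer ν).index ∧
          ∃ v : V, v ≠ 0 ∧ ∀ y ∈ Y, ρ y v = v := by
  classical
  -- the induced module `U ⊆ (𝔖_n → V)`
  let U : Submodule ℂ (Equiv.Perm (Fin n) → V) :=
    { carrier := {f | ∀ (a : ↥(alternatingGroup (Fin n))) (x : Equiv.Perm (Fin n)),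
        f ((a : Equiv.Perm (Fin n)) * x) = ρ a (f x)}
      zero_mem' := by intro a x; simp
      add_mem' := by
        intro f g hf hg a x
        simp only [Pi.add_apply, map_add, hf a x, hg a x]
      smul_mem' := by
        intro c f hf a x
        simp only [Pi.smul_apply, map_smul, hf a x] }
  have hU : ∀ f : Equiv.Perm (Fin n) → V, f ∈ U ↔ ∀ (a : ↥(alternatingGroup (Fin n))) (x : Equiv.Perm (Fin n)),
      f ((a : Equiv.Perm (Fin n)) * x) = ρ a (f x) := fun f => Iff.rfl
  -- right translation
  have hmem : ∀ g : Equiv.Perm (Fin n), ∀ f : Equiv.Perm (Fin n) → V, f ∈ U →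
      (fun x => f (x * g)) ∈ U := by
    intro g f hf
    refine (hU _).2 fun a x => ?_
    rw [mul_assoc]
    exact (hU f).1 hf a (x * g)
  let T : Equiv.Perm (Fin n) → (U →ₗ[ℂ] U) := fun g =>
    { toFun := fun f => ⟨fun x => (f : Equiv.Perm (Fin n) → V) (x * g), hmem g f f.2⟩
      map_add' := fun f f' => rfl
      map_smul' := fun c f => rfl }
  have hT : ∀ (g : Equiv.Perm (Fin n)) (f : U) (x : Equiv.Perm (Fin n)),
      ((T g f : U) : Equiv.Perm (Fin n) → V) x = (f : Equiv.Perm (Fin n) → V) (x * g) :=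
    fun _ _ _ => rfl
  let π : Representation ℂ (Equiv.Perm (Fin n)) U :=
    { toFun := T
      map_one' := by
        apply LinearMap.ext
        intro f
        apply Subtype.ext
        funext x
        rw [hT, mul_one]
        rfl
      map_mul' := by
        intro g h
        apply LinearMap.ext
        intro f
        apply Subtype.ext
        funext x
        rw [hT, Module.End.mul_apply, hT, hT, mul_assoc] }
  have hπ : ∀ (g : Equiv.Perm (Fin n)) (f : U) (x : Equiv.Perm (Fin n)),
      ((π g f : U) : Equiv.Perm (Fin n) → V) x = (f : Equiv.Perm (Fin n) → V) (x * g) :=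
    fun _ _ _ => rfl
  clear_value π T U
  -- `U ≠ 0`
  obtain ⟨v₀, hv₀⟩ := exists_ne (0 : V)
  let f₀ : Equiv.Perm (Fin n) → V := fun x => if hx : x ∈ (alternatingGroup (Fin n)) then ρ ⟨x, hx⟩ v₀ else 0
  have hf₀ : f₀ ∈ U := by
    refine (hU f₀).2 ?_
    intro a x
    by_cases hx : x ∈ (alternatingGroup (Fin n))
    · have hax : (a : Equiv.Perm (Fin n)) * x ∈ (alternatingGroup (Fin n)) := mul_mem a.2 hx
      have hprod : (⟨(a : Equiv.Perm (Fin n)) * x, hax⟩ : ↥(alternatingGroup (Fin n))) = a * ⟨x, hx⟩ := rfl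
      simp only [f₀, dif_pos hx, dif_pos hax, hprod, map_mul, Module.End.mul_apply]
    · have hax : (a : Equiv.Perm (Fin n)) * x ∉ (alternatingGroup (Fin n)) := by
        intro h
        apply hx
        have := mul_mem (inv_mem a.2) h
        rwa [inv_mul_cancel_left] at this
      simp only [f₀, dif_neg hx, dif_neg hax, map_zero]
  have hf₀ne : (⟨f₀, hf₀⟩ : U) ≠ 0 := by
    intro h
    have h1 : f₀ 1 = 0 := by
      have := congrArg (fun f : U => (f : Equiv.Perm (Fin n) → V) 1) h
      simpa using this
    have h2 : f₀ 1 = v₀ := by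
      have h1A : (1 : Equiv.Perm (Fin n)) ∈ (alternatingGroup (Fin n)) := one_mem (alternatingGroup (Fin n))
      have hone : (⟨(1 : Equiv.Perm (Fin n)), h1A⟩ : ↥(alternatingGroup (Fin n))) = 1 := rfl
      simp only [f₀, dif_pos h1A, hone, map_one, Module.End.one_apply]
    exact hv₀ (h2 ▸ h1)
  haveI : Nontrivial U := ⟨⟨_, 0, hf₀ne⟩⟩
  -- an irreducible subrepresentation and its Specht model
  obtain ⟨σ₁, hσ₁, hirr⟩ := exists_irreducible_subrepresentation π
  haveI := hirr
  obtain ⟨lam, ⟨e⟩⟩ :=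
    exists_equiv_spechtRep_of_isIrreducible_holds (k := ℂ) (V := ↥σ₁.toSubmodule) σ₁.toRepresentation
  -- dimension count
  have h4 : Module.finrank ℂ U ≤ 2 * Module.finrank ℂ V := by
    have hs : ∃ s : Equiv.Perm (Fin n), ∀ x : Equiv.Perm (Fin n), x ∈ (alternatingGroup (Fin n)) ∨ x * s⁻¹ ∈ (alternatingGroup (Fin n)) := by
      by_cases h : ∃ s : Equiv.Perm (Fin n), s ∉ (alternatingGroup (Fin n))
      · obtain ⟨s, hs⟩ := h
        refine ⟨s, fun x => ?_⟩
        by_cases hx : x ∈ (alternatingGroup (Fin n))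
        · exact Or.inl hx
        · right
          rw [Equiv.Perm.mem_alternatingGroup] at hx hs ⊢
          have hx' : Equiv.Perm.sign x = -1 := (Int.units_eq_one_or _).resolve_left hx
          have hs' : Equiv.Perm.sign s = -1 := (Int.units_eq_one_or _).resolve_left hs
          rw [map_mul, map_inv, hx', hs', mul_inv_cancel]
      · refine ⟨1, fun x => Or.inl ?_⟩
        by_contra hx
        exact h ⟨x, hx⟩
    obtain ⟨s, hs⟩ := hs
    let ev : U →ₗ[ℂ] V × V :=
      { toFun := fun f => ((f : Equiv.Perm (Fin n) → V) 1, (f : Equiv.Perm (Fin n) → V) s)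
        map_add' := fun f g => rfl
        map_smul' := fun c f => rfl }
    have hev : Function.Injective ev := by
      intro f g hfg
      apply Subtype.ext
      funext x
      have h1 : (f : Equiv.Perm (Fin n) → V) 1 = (g : Equiv.Perm (Fin n) → V) 1 := congrArg Prod.fst hfg
      have h2 : (f : Equiv.Perm (Fin n) → V) s = (g : Equiv.Perm (Fin n) → V) s := congrArg Prod.snd hfg
      rcases hs x with hx | hx
      · have hf := (hU f).1 f.2 ⟨x, hx⟩ 1
        have hg := (hU g).1 g.2 ⟨x, hx⟩ 1
        simp only [mul_one] at hf hg
        rw [hf, hg, h1]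
      · have hf := (hU f).1 f.2 ⟨x * s⁻¹, hx⟩ s
        have hg := (hU g).1 g.2 ⟨x * s⁻¹, hx⟩ s
        simp only [inv_mul_cancel_right] at hf hg
        rw [hf, hg, h2]
    calc Module.finrank ℂ U ≤ Module.finrank ℂ (V × V) := LinearMap.finrank_le_finrank_of_injective hev
      _ = 2 * Module.finrank ℂ V := by rw [Module.finrank_prod]; ring
  have hdim : numStandardTableaux lam ≤ 2 * Module.finrank ℂ V := by
    have h1 : Module.finrank ℂ (spechtIdeal ℂ lam) = numStandardTableaux lam :=
      finrank_spechtIdeal_holds (k := ℂ) lam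
    have h2 : Module.finrank ℂ σ₁.toSubmodule = Module.finrank ℂ (spechtIdeal ℂ lam) :=
      e.toLinearEquiv.finrank_eq
    have h3 : Module.finrank ℂ σ₁.toSubmodule ≤ Module.finrank ℂ U := Submodule.finrank_le _
    omega
  refine ⟨lam, hdim, fun ν hν => ?_⟩
  -- a nonzero vector of `S^λ` fixed by `R_ν ∩ 𝔄_n`
  have hw : ∃ w : spechtIdeal ℂ lam, w ≠ 0 ∧ ∀ p ∈ rowStabilizer ν, p ∈ (alternatingGroup (Fin n)) → spechtRep ℂ lam p w = w := by
    rcases hν with h | h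
    · rw [h]
      obtain ⟨w, hw0, hw⟩ := exists_fixed_rowStabilizer lam
      exact ⟨w, hw0, fun p hp _ => hw p hp⟩
    · rw [h]
      exact exists_fixed_rowStabilizer_transpose lam
  obtain ⟨w, hw0, hw⟩ := hw
  -- transport to `σ₁ ⊆ U`
  set u : σ₁.toSubmodule := e.symm w with hu
  have hu0 : u ≠ 0 := by
    intro h
    apply hw0
    apply (EquivLike.injective e.symm)
    rw [← hu, h, map_zero]
  have hufix : ∀ p ∈ rowStabilizer ν, p ∈ (alternatingGroup (Fin n)) → σ₁.toRepresentation p u = u := by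
    intro p hp hpA
    rw [hu]
    have h := Representation.IntertwiningMap.isIntertwining _ _ e.symm.toIntertwiningMap p w
    rw [hw p hp hpA, Representation.Equiv.coe_toIntertwiningMap] at h
    exact h.symm
  set uf : Equiv.Perm (Fin n) → V := ((u : U) : Equiv.Perm (Fin n) → V) with huf
  have hufU : uf ∈ U := (u : U).2
  have hfixfun : ∀ p ∈ rowStabilizer ν, p ∈ (alternatingGroup (Fin n)) → ∀ x, uf (x * p) = uf x := by
    intro p hp hpA x
    have h1 : ((σ₁.toRepresentation p u : σ₁.toSubmodule) : U) = π p (u : U) := rfl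
    have h2 := congrArg (fun z : σ₁.toSubmodule => ((z : U) : Equiv.Perm (Fin n) → V) x)
      (hufix p hp hpA)
    rw [h1, hπ] at h2
    rw [huf]
    exact h2
  have hne : ∃ x₀, uf x₀ ≠ 0 := by
    by_contra h
    rw [not_exists] at h
    apply hu0
    have h1 : uf = 0 := funext fun x => not_not.mp (h x)
    have h2 : (u : U) = 0 := Subtype.ext h1
    exact Subtype.ext (by rw [h2]; rfl)
  obtain ⟨x₀, hx₀⟩ := hne
  refine ⟨(((rowStabilizer ν ⊓ (alternatingGroup (Fin n))).map ((MulAut.conj x₀ : Equiv.Perm (Fin n) ≃* Equiv.Perm (Fin n)) :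
      Equiv.Perm (Fin n) →* Equiv.Perm (Fin n))).subgroupOf (alternatingGroup (Fin n))),
    index_conj_inf_subgroupOf_le (rowStabilizer ν) x₀, uf x₀, hx₀, fun y hy => ?_⟩
  rw [Subgroup.mem_subgroupOf] at hy
  obtain ⟨p, ⟨hpR, hpA⟩, hpy⟩ := Subgroup.mem_map.mp hy
  have h1 : uf ((y : Equiv.Perm (Fin n)) * x₀) = ρ y (uf x₀) := (hU uf).1 hufU y x₀
  rw [← h1]
  have h2 : (y : Equiv.Perm (Fin n)) * x₀ = x₀ * p := by
    rw [← hpy]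
    change (MulAut.conj x₀) p * x₀ = x₀ * p
    rw [MulAut.conj_apply, inv_mul_cancel_right]
  rw [h2]
  exact hfixfun p hpR hpA x₀

end Summit.ValiantsHypothesis.ValiantsHypothesis.Theorems.SymPencilEquivariantSdcNotQP.YoungBounds

end
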